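import Summits.Ventures.YMGap.RobustBall.UniformMassGapDim3
import Summits.Ventures.YMGap.RobustBall.UniformPlaquetteDecay
import HarnessLib

/-!
# Venture YMGap, track ROBUST-BALL (Y2) — `ℤ³` (the YM₃ lane's lattice): the certified uniform rate grows logarithmically,
# `m(β_W) ≥ log(1/(6β_W))` at the Wilson point and on the loop ball

HONEST FRAMING. WHAT THIS IS: a venture file (cell `pub-ymgap`, track Y2 ROBUST-BALL, seat rb-p1, theorems only), the `d = 3` companion of
`UniformRateStrongCoupling.lean`: the every-`d` tier-2 `SU(2)` door `2(d−1)|β_W| e^{a} e^{t} + e^{a/2}√(2/3)Λ < 1` read at `d = 3` with the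
weight `e^{t} = 1/(6|β_W|)` (so `4|β_W| e^{t} = 2/3`):
* `su2_dim3_uniformBallZdS_rate` — `0 < |β_W| < 1/6`, loads with `(2/3)e^{a} + e^{a/2}√(2/3)Λ < 1`:
  `UniformMassGapOnBallZdS 3 2 (β_W/4) a Λ (log(1/(6|β_W|))) (log(1/(6|β_W|))) 16`;
* `su2_dim3_wilson_clustering_rate` — EVERY DLR state of `SU(2)` Wilson on `ℤ³` at `0 < |β_W| < 1/6` clusters at rate `log(1/(6|β_W|))` with
  constant `16 n²` (both signs); plaquette two-point reading `su2_dim3_wilson_plaquette_decay_rate`;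
* `su2_dim3_uniformLoopBall_rate` — `0 < β_W < 1/6`: the `ℤ³` loop ball `‖c‖_{log(1/(6β_W))} ≤ 1/10` is uniform with the same rate
  (lineage A: `(2/3)T(1/5) + T(1/10)·0.08165 ≤ 0.905 < 1`).
WHAT THIS IS NOT: lower bounds (coefficient `1·log(1/β_W)`); lattice strong coupling on `ℤ³`; nothing about `YM₃` in the continuum or Clay.
-/

noncomputable section

open MeasureTheory Filter Function ProbabilityTheory Real
open scoped NNReal
open Literature.Probability.LatticeModels
open Literature.Probability.LatticeModels.DobrushinMetric
open Literature.MathematicalPhysics.QuantumLattice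
open Literature.MathematicalPhysics.QuantumFieldTheory hiding ZdEdge Site

namespace Summit.Ventures.YMGap.RobustBall

/-- **THE TIER-2 `SU(2)` BALL ON `ℤ³` AT THE MAXIMAL WEIGHT**: for `0 < |β_W| < 1/6` and loads with `(2/3) e^{a} + e^{a/2}√(2/3) Λ < 1`:
`UniformMassGapOnBallZdS 3 2 (β_W/4) a Λ (log(1/(6|β_W|))) (log(1/(6|β_W|))) 16`. [folklore] -/
theorem su2_dim3_uniformBallZdS_rate {βW a Λ : ℝ} (h0 : 0 < |βW|) (h : |βW| < 1 / 6)
    (hρ : 2 / 3 * Real.exp a + Real.exp (a / 2) * Real.sqrt (2 / 3) * Λ < 1) :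
    UniformMassGapOnBallZdS 3 2 (βW / 4) a Λ (Real.log (1 / (6 * |βW|))) (Real.log (1 / (6 * |βW|))) 16 := by
  have hq0 : 0 < 1 / (6 * |βW|) := by positivity
  have ht : 0 < Real.log (1 / (6 * |βW|)) := Real.log_pos (by rw [lt_div_iff₀ (by positivity)]; linarith)
  refine su2_uniformMassGapOnBallZdS (d := 3) (by norm_num) ht ?_
  rw [Real.exp_log hq0]
  have e : 2 * (((3 : ℕ) : ℝ) - 1) * |βW| * (Real.exp a * (1 / (6 * |βW|))) = 2 / 3 * Real.exp a := by
    push_cast; field_simp; ring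
  rw [e]; exact hρ

/-- **EVERY DLR STATE OF `SU(2)` WILSON ON `ℤ³` AT `0 < |β_W| < 1/6` CLUSTERS AT RATE `log(1/(6|β_W|))`**, constant `16 n²`. [folklore] -/
theorem su2_dim3_wilson_clustering_rate {βW : ℝ} (h0 : 0 < |βW|) (h : |βW| < 1 / 6) :
    PerturbedClustering 3 2 (βW / 4) 0 (fun _ => (∅ : Finset (Finset (ZdEdge 3)))) (Real.log (1 / (6 * |βW|))) 16 := by
  have hS := su2_dim3_uniformBallZdS_rate (a := 0) (Λ := 0) h0 h (by rw [Real.exp_zero, zero_div, Real.exp_zero]; norm_num)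
  have ht : 0 ≤ Real.log (1 / (6 * |βW|)) := (Real.log_pos (by rw [lt_div_iff₀ (by positivity)]; linarith)).le
  have hZd : UniformMassGapOnBallZd 3 2 (βW / 4) 0 0 0 (Real.log (1 / (6 * |βW|))) 16 :=
    hS.uniformMassGapOnBallZd ht le_rfl (by simp)
  exact hZd.clustering_wilson le_rfl le_rfl

/-- **Plaquette two-point reading on `ℤ³`**: for `0 < |β_W| < 1/6`, every DLR state `μ ∈ ymGibbsMeasures (fundamentalRep (Fin 2)) (β_W/2)` of `SU(2)`
on `ℤ³`, every two plaquettes: `|Cov_μ(W_p(x), W_q(y))| ≤ C · e^{−log(1/(6|β_W|))‖x−y‖_∞} = C·(6|β_W|)^{‖x−y‖_∞}` with the explicit constant of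
`UniformPlaquetteDecay.lean` at `(m, A) = (log(1/(6|β_W|)), 16)`. [folklore] -/
theorem su2_dim3_wilson_plaquette_decay_rate {βW : ℝ} (h0 : 0 < |βW|) (h : |βW| < 1 / 6)
    {μ : Measure (LGConfig 3 (SUN 2))} (hμ : μ ∈ ymGibbsMeasures (d := 3) (fundamentalRep (Fin 2)) (βW / 2))
    (x y : Literature.Probability.LatticeModels.Site 3) {i j k l : Fin 3} (hij : i < j) (hkl : k < l) :
    |cov[zdPlaquetteObs (fundamentalRep (Fin 2)) x i j, zdPlaquetteObs (fundamentalRep (Fin 2)) y k l; μ]| ≤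
      max (max ((16 : ℝ) * (4 : ℕ) ^ 2) 0 * Real.exp (2 * Real.log (1 / (6 * |βW|))) *
          (((4 * ((2 : ℕ) : ℝ≥0) ^ 3 : ℝ≥0) : ℝ) * ((4 * ((2 : ℕ) : ℝ≥0) ^ 3 : ℝ≥0) : ℝ) + 1))
        (4 * Real.exp (2 * Real.log (1 / (6 * |βW|)))) * Real.exp (-Real.log (1 / (6 * |βW|)) * ‖x - y‖) := by
  have hμ' : μ ∈ perturbedGibbsMeasures (d := 3) (fundamentalRep (Fin 2)) (2 * (βW / 4)) 0
      (fun _ => (∅ : Finset (Finset (ZdEdge 3)))) := by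
    rw [perturbedGibbsMeasures_zero]
    have e : (2 : ℝ) * (βW / 4) = βW / 2 := by ring
    rwa [e]
  exact (su2_dim3_wilson_clustering_rate h0 h).abs_cov_plaquette_le
    (Real.log_pos (by rw [lt_div_iff₀ (by positivity)]; linarith)) hμ' x y hij hkl

/-- **THE `ℤ³` LOOP BALL AT RATE `log(1/(6β_W))`**: for `0 < β_W < 1/6`, every generic Wilson-type loop action on `ℤ³` with finite carrier fibres
and `‖c‖_{log(1/(6β_W))} ≤ 1/10` has one DLR state and ALL of them cluster at rate `log(1/(6β_W))` with constant `16 n²`. [folklore] -/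
theorem su2_dim3_uniformLoopBall_rate {βW : ℝ} (h0 : 0 < βW) (h : βW < 1 / 6) :
    UniformMassGapOnLoopBall 3 2 (βW / 4) (Real.log (1 / (6 * βW))) (1 / 10) (Real.log (1 / (6 * βW))) 16 := by
  have hq : 1 < 1 / (6 * βW) := by rw [lt_div_iff₀ (by positivity)]; linarith
  have hrow : UniformMassGapOnBallZdS 3 2 (βW / 4) (2 * (1 / 10)) (1 / 10) (Real.log (1 / (6 * βW)))
      (Real.log (1 / (6 * βW))) 16 := by
    refine su2_uniformRowS_dim (d := 3) (by norm_num) hq h0.le (by norm_num) (by norm_num) ?_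
    have e : 2 * (((3 : ℕ) : ℝ) - 1) * βW * (1 / (6 * βW)) = 2 / 3 := by
      push_cast; field_simp; ring
    rw [e]
    norm_num
  exact hrow.uniformMassGapOnLoopBall

end Summit.Ventures.YMGap.RobustBall

end
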